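import Literature.NumberTheory.ComplexMultiplication.CMTypeRankSharedOddCharacter
import Literature.NumberTheory.ComplexMultiplication.PartialConjugationOfRealIntersection
import Literature.AlgebraicGeometry.Pohlmann1968.CMTypeRankCharactersNumberField
import Literature.AlgebraicGeometry.Pohlmann1968.NondegenerateCMAlgebraTypes
import HarnessLib

/-!
# CM fields through a common normal subfield carrying an ODD ABELIAN CHARACTER: every family of CM types with two
# NONDEGENERATE members over such fields is DEGENERATE (exceptional Hodge classes on `A₀^a × A₁^b`)

Number-field form of `NumberTheory/ComplexMultiplication/CMTypeRankSharedOddCharacter` (abstract: two nondegenerate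
slots carrying non-zero weights that transform under one ODD character of the acting group make the rank of the family
non-additive, hence the family degenerate).  Setting: CM fields `K_i` (`i ∈ I`), `G = Aut(ℂ)` acting on
`Hom(K_i, ℂ)` by composition, `ρ` = complex conjugation (`Pohlmann1968.isCMTypeWith_conj`), Deligne's rank
`CMAlgebra.cmFamilyRank Φ = rank Y(MT(∏_i A_{Φ_i}))` and `CMAlgebra.IsNondegenerateFamily`.

An **odd character of `Aut(ℂ)` local on `S ⊆ ℂ`** is a multiplicative `χ : Aut(ℂ) → ℂ` with `χ(conj) = −1` whose value
`χ(τ)` only depends on `τ|_S`.  If `S` lies inside `φ₀(K_{i₀})` and inside `φ₁(K_{i₁})` for some complex embeddings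
`φ_k`, then `f_k(s) = χ(τ_s)` (`τ_s ∘ φ_k = s`; well defined by locality, `Aut(ℂ)` being transitive on `Hom(K, ℂ)`) are
non-zero weights on the two slots transforming under the same `χ` (`exists_semiInvariant_of_local`), and the abstract
file applies:

* **`cmFamilyRank_add_card_lt_of_shared_oddChar`**, **`not_isNondegenerateFamily_of_shared_oddChar`**,
  `not_forall_exists_partialConj_of_shared_oddChar` — weights given: for NONDEGENERATE `Φ_{i₀}`, `Φ_{i₁}` the rank is
  not additive (`cmFamilyRank Φ + |I| < Σ_i cmTypeRank Φ_i + 1`, i.e. `rank Hg(∏ A_i) < Σ rank Hg(A_i)`), the family is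
  DEGENERATE whatever the other slots (Murty–Hazama: exceptional Hodge classes on some `∏_i A_i^{k_i}`), and no system
  of partial conjugations exists;
* **`not_isNondegenerateFamily_of_oddChar_local`** — the same from an odd character local on a set
  `S ⊆ φ₀(K_{i₀}) ∩ φ₁(K_{i₁})`;
* **`exists_oddChar_of_abelian`** — SUPPLY: if `F ≤ ℂ` is a finite normal extension of `ℚ` on which the automorphisms
  of `ℂ` COMMUTE (`τ τ' x = τ' τ x` for `x ∈ F`, i.e. `Gal(F/ℚ)` is abelian) and which complex conjugation does NOT fix
  pointwise (`F` is a CM field, not totally real), there is an odd character of `Aut(ℂ)` local on `F` (a character `ψ` of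
  the finite abelian group `Aut(ℂ)|_F` with `ψ(conj|_F) = −1`, by Pontryagin duality `AddChar.exists_apply_ne_zero`);
* **`not_isNondegenerateFamily_of_common_subfield`**, **`cmFamilyRank_add_card_lt_of_common_subfield`** — CONSEQUENTLY:
  if such an `F` lies in `φ₀(K_{i₀})` and in `φ₁(K_{i₁})` (`i₀ ≠ i₁`), every family `Φ` with `Φ_{i₀}`, `Φ_{i₁}`
  nondegenerate is degenerate;
* the number-field dress (a common ABELIAN CM subfield `k ↪ K_{i₀}, K_{i₁}`; NESTED abelian CM fields; cyclotomic
  fields of nested levels) is `NumberTheory/ComplexMultiplication/CommonAbelianCMSubfieldDegenerate`.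

This is the exact converse, for fields with abelian Galois closure, of the pairwise real-intersection criterion
(`PartialConjugationOfRealIntersection`, `CMTypeRankCommonConstituent.pairwise_of_partialConj`): for ABELIAN CM fields a
family with nondegenerate members is nondegenerate iff the fields pairwise meet in totally real fields
(`Summits/HodgeConjecture/CorCM/AbelianCMFieldsHodge`).  It is the negative complement of the coprime-level theorem
`slotwiseIndependent_of_coprime_cyclotomic` (`IndependentCMFieldsHodge`): cyclotomic fields of NESTED levels never give
stably nondegenerate products of nondegenerate CM abelian varieties.

Everything is proved; no definition, no named fact, no `sorry`.

## References

* [Kubota1965] T. Kubota, *On the field extension by complex multiplication*, Trans. AMS 118 (1965), §4 Lemma 2 (odd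
  characters of an abelian CM field govern the rank).
* [Gordon1999HodgeAVSurvey] B. B. Gordon, *A survey of the Hodge conjecture for abelian varieties*, §3 Theorem (Imai,
  Murty) and proof; 7.5–7.7 (Murty, Hazama); Prop. 9.4.1.
* [Deligne1982HodgeCycles] P. Deligne, *Hodge cycles on abelian varieties*, LNM 900 (1982), I Ex. 3.7.
* [Shimura1998] G. Shimura, *Abelian Varieties with Complex Multiplication and Modular Functions*, §8.1 (Galois action
  on embeddings), §18.2 Lemma.
-/

set_option autoImplicit false

noncomputable section

open scoped BigOperators
open NumberField NumberField.ComplexEmbedding Module IntermediateField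

namespace Literature.NumberTheory.ComplexMultiplication

open Literature.AlgebraicGeometry.Motives (CMType)
open Literature.AlgebraicGeometry.Pohlmann1968

/-! ### Odd characters of `Aut(ℂ)` -/

section OddChar

/-- A multiplicative function on `Aut(ℂ)` taking the value `−1` somewhere takes the value `1` at the identity. [folklore] -/
private theorem oddChar_one (χ : (ℂ ≃+* ℂ) → ℂ) (hmul : ∀ τ τ' : ℂ ≃+* ℂ, χ (τ * τ') = χ τ * χ τ')
    (hodd : χ (starRingAut : ℂ ≃+* ℂ) = -1) : χ 1 = 1 := by
  have h1 : χ (starRingAut : ℂ ≃+* ℂ) = χ (starRingAut : ℂ ≃+* ℂ) * χ 1 := by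
    rw [← hmul, mul_one]
  rw [hodd] at h1
  have : (-1 : ℂ) * χ 1 = -1 * 1 := by rw [← h1, mul_one]
  exact mul_left_cancel₀ (by norm_num) this

/-- A multiplicative function on `Aut(ℂ)` with `χ(1) = 1` never vanishes (`χ(τ) χ(τ⁻¹) = 1`). [folklore] -/
private theorem oddChar_ne_zero (χ : (ℂ ≃+* ℂ) → ℂ) (hmul : ∀ τ τ' : ℂ ≃+* ℂ, χ (τ * τ') = χ τ * χ τ')
    (h1 : χ 1 = 1) (τ : ℂ ≃+* ℂ) : χ τ ≠ 0 := by
  intro h0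
  have := hmul τ τ⁻¹
  rw [mul_inv_cancel, h1, h0, zero_mul] at this
  exact one_ne_zero this

end OddChar

/-! ### Semi-invariant weights on `Hom(K, ℂ)` from a local character -/

section Weight

variable {K : Type} [Field K] [NumberField K]

/-- **The weight `f(s) = χ(τ_s)` (`τ_s ∘ φ = s`) attached to a multiplicative `χ : Aut(ℂ) → ℂ` LOCAL at the base
embedding `φ : K → ℂ`** (`χ(τ)` only depends on `τ ∘ φ`): it is well defined (`Aut(ℂ)` is transitive on `Hom(K, ℂ)`,
Shimura §8.1), non-zero (`f(φ) = χ(1) ≠ 0`) and semi-invariant: `f(τ ∘ s) = χ(τ) f(s)`.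
[cite: Shimura1998, §8.1] -/
theorem exists_semiInvariant_of_local (χ : (ℂ ≃+* ℂ) → ℂ) (hmul : ∀ τ τ' : ℂ ≃+* ℂ, χ (τ * τ') = χ τ * χ τ')
    (h1 : χ 1 ≠ 0) (φ : K →+* ℂ)
    (hloc : ∀ τ τ' : ℂ ≃+* ℂ, τ • φ = τ' • φ → χ τ = χ τ') :
    ∃ f : (K →+* ℂ) → ℂ, f ≠ 0 ∧ ∀ (τ : ℂ ≃+* ℂ) (s : K →+* ℂ), f (τ • s) = χ τ * f s := by
  haveI := isPretransitive_ringEquiv_complex (K := K)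
  choose T hT using fun s : K →+* ℂ => MulAction.exists_smul_eq (ℂ ≃+* ℂ) φ s
  refine ⟨fun s => χ (T s), fun h0 => ?_, fun τ s => ?_⟩
  · have hφ : χ (T φ) = χ 1 := hloc _ _ (by rw [hT, one_smul])
    have h := congrFun h0 φ
    simp only [Pi.zero_apply] at h
    exact h1 (hφ ▸ h)
  · show χ (T (τ • s)) = χ τ * χ (T s)
    rw [← hmul]
    exact hloc _ _ (by rw [hT, mul_smul, hT])

omit [NumberField K] in
/-- Locality at `φ` from locality on a SET `S ⊆ φ(K)`: automorphisms agreeing on `φ(K)` agree on `S`. [folklore] -/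
private theorem local_of_subset_range (χ : (ℂ ≃+* ℂ) → ℂ) (S : Set ℂ)
    (hloc : ∀ τ τ' : ℂ ≃+* ℂ, (∀ x ∈ S, τ x = τ' x) → χ τ = χ τ') (φ : K →+* ℂ) (hS : S ⊆ Set.range φ)
    (τ τ' : ℂ ≃+* ℂ) (h : τ • φ = τ' • φ) : χ τ = χ τ' := by
  refine hloc τ τ' fun x hx => ?_
  obtain ⟨y, rfl⟩ := hS hx
  have := RingHom.congr_fun h y
  simpa only [ringEquiv_smul_apply] using this

end Weight

/-! ### Degeneracy of families with two nondegenerate members sharing an odd character -/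

section Family

variable {I : Type} {K : I → Type} [∀ i, Field (K i)] [∀ i, NumberField (K i)] [∀ i, IsCMField (K i)] [Fintype I]
  [Nonempty I]

omit [∀ i, IsCMField (K i)] [Nonempty I] in
/-- `|⊔_i Hom(K_i, ℂ)| = Σ_i [K_i : ℚ]`. [folklore] -/
private theorem card_sigma_ringHom_eq_sum :
    Fintype.card ((i : I) × (K i →+* ℂ)) = ∑ i, finrank ℚ (K i) := by
  rw [Fintype.card_sigma]
  exact Finset.sum_congr rfl fun i _ => Embeddings.card (K i) ℂ

omit [Fintype I] [Nonempty I] [∀ i, IsCMField (K i)] in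
/-- Nondegeneracy of `Φ_i` in the abstract normalisation `rank = |Hom(K_i, ℂ)|/2 + 1`. [cite: Kubota1965, §2 (p. 115)] -/
private theorem typeRank_eq_of_isNondegenerate {i : I} {Φ : ∀ i, CMType (K i)} (h : IsNondegenerate (Φ i)) :
    typeRank (ℂ ≃+* ℂ) (Φ i).1 = Fintype.card (K i →+* ℂ) / 2 + 1 := by
  rw [Embeddings.card]; exact h

/-- **Shared odd character, nondegenerate members ⟹ the rank is not additive**: if `Φ_{i₀}`, `Φ_{i₁}` (`i₀ ≠ i₁`) are
nondegenerate and the slots `Hom(K_{i₀}, ℂ)`, `Hom(K_{i₁}, ℂ)` carry non-zero weights `f₀`, `f₁` with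
`f_k(τ ∘ s) = χ(τ) f_k(s)` for one `χ` with `χ(conj) = −1`, then `cmFamilyRank Φ + |I| < Σ_i cmTypeRank Φ_i + 1`
(`rank Hg(∏_i A_{Φ_i}) < Σ_i rank Hg(A_{Φ_i})`). [cite: Gordon1999HodgeAVSurvey, §3 Theorem (proof) and 7.5]
[cite: Kubota1965, §4 Lemma 2] -/
theorem cmFamilyRank_add_card_lt_of_shared_oddChar {i₀ i₁ : I} (h01 : i₀ ≠ i₁) (Φ : ∀ i, CMType (K i))
    (hnd₀ : IsNondegenerate (Φ i₀)) (hnd₁ : IsNondegenerate (Φ i₁)) (χ : (ℂ ≃+* ℂ) → ℂ)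
    (hodd : χ (starRingAut : ℂ ≃+* ℂ) = -1) (f₀ : (K i₀ →+* ℂ) → ℂ) (f₁ : (K i₁ →+* ℂ) → ℂ) (hf₀0 : f₀ ≠ 0)
    (hf₁0 : f₁ ≠ 0) (hf₀ : ∀ (τ : ℂ ≃+* ℂ) (s : K i₀ →+* ℂ), f₀ (τ • s) = χ τ * f₀ s)
    (hf₁ : ∀ (τ : ℂ ≃+* ℂ) (s : K i₁ →+* ℂ), f₁ (τ • s) = χ τ * f₁ s) :
    CMAlgebra.cmFamilyRank Φ + Fintype.card I < (∑ i, cmTypeRank (Φ i)) + 1 := by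
  classical
  exact typeRank_sigmaType_add_card_lt_of_shared_odd (G := ℂ ≃+* ℂ) (F := ℂ) (Φ := fun i => (Φ i).1)
    (fun i => isCMTypeWith_conj (Φ i)) h01 (typeRank_eq_of_isNondegenerate hnd₀)
    (typeRank_eq_of_isNondegenerate hnd₁) χ hodd f₀ f₁ hf₀0 hf₁0 hf₀ hf₁

/-- **Shared odd character, nondegenerate members ⟹ the family is DEGENERATE** (`¬ IsNondegenerateFamily Φ`), whatever
the other slots — on abelian varieties: some `∏_i A_i^{k_i}` carries an exceptional Hodge class although `A_{i₀}` and
`A_{i₁}` are nondegenerate. [cite: Gordon1999HodgeAVSurvey, 7.5–7.7] [cite: Kubota1965, §4 Lemma 2] -/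
theorem not_isNondegenerateFamily_of_shared_oddChar {i₀ i₁ : I} (h01 : i₀ ≠ i₁) (Φ : ∀ i, CMType (K i))
    (hnd₀ : IsNondegenerate (Φ i₀)) (hnd₁ : IsNondegenerate (Φ i₁)) (χ : (ℂ ≃+* ℂ) → ℂ)
    (hodd : χ (starRingAut : ℂ ≃+* ℂ) = -1) (f₀ : (K i₀ →+* ℂ) → ℂ) (f₁ : (K i₁ →+* ℂ) → ℂ) (hf₀0 : f₀ ≠ 0)
    (hf₁0 : f₁ ≠ 0) (hf₀ : ∀ (τ : ℂ ≃+* ℂ) (s : K i₀ →+* ℂ), f₀ (τ • s) = χ τ * f₀ s)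
    (hf₁ : ∀ (τ : ℂ ≃+* ℂ) (s : K i₁ →+* ℂ), f₁ (τ • s) = χ τ * f₁ s) :
    ¬ CMAlgebra.IsNondegenerateFamily Φ := by
  classical
  intro hnd
  rw [CMAlgebra.isNondegenerateFamily_iff, ← card_sigma_ringHom_eq_sum (K := K)] at hnd
  exact typeRank_sigmaType_ne_of_shared_odd (G := ℂ ≃+* ℂ) (F := ℂ) (Φ := fun i => (Φ i).1)
    (fun i => isCMTypeWith_conj (Φ i)) h01 (typeRank_eq_of_isNondegenerate hnd₀)
    (typeRank_eq_of_isNondegenerate hnd₁) χ hodd f₀ f₁ hf₀0 hf₁0 hf₀ hf₁ hnd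

/-- **No system of partial conjugations** exists in this situation (for some `i`, `L_i ∩ ∏_{j≠i} L_j` is not totally
real). [cite: Gordon1999HodgeAVSurvey, §3 Theorem (proof)] -/
theorem not_forall_exists_partialConj_of_shared_oddChar {i₀ i₁ : I} (h01 : i₀ ≠ i₁) (Φ : ∀ i, CMType (K i))
    (hnd₀ : IsNondegenerate (Φ i₀)) (hnd₁ : IsNondegenerate (Φ i₁)) (χ : (ℂ ≃+* ℂ) → ℂ)
    (hodd : χ (starRingAut : ℂ ≃+* ℂ) = -1) (f₀ : (K i₀ →+* ℂ) → ℂ) (f₁ : (K i₁ →+* ℂ) → ℂ) (hf₀0 : f₀ ≠ 0)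
    (hf₁0 : f₁ ≠ 0) (hf₀ : ∀ (τ : ℂ ≃+* ℂ) (s : K i₀ →+* ℂ), f₀ (τ • s) = χ τ * f₀ s)
    (hf₁ : ∀ (τ : ℂ ≃+* ℂ) (s : K i₁ →+* ℂ), f₁ (τ • s) = χ τ * f₁ s) :
    ¬ ∀ i : I, ∃ σ : ℂ ≃+* ℂ, (∀ s : K i →+* ℂ, σ • s = (starRingAut : ℂ ≃+* ℂ) • s) ∧
      ∀ j, j ≠ i → ∀ s : K j →+* ℂ, σ • s = s := by
  classical
  exact not_forall_exists_partialConj_of_shared_odd (G := ℂ ≃+* ℂ) (F := ℂ) (Φ := fun i => (Φ i).1)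
    (fun i => isCMTypeWith_conj (Φ i)) h01 (typeRank_eq_of_isNondegenerate hnd₀)
    (typeRank_eq_of_isNondegenerate hnd₁) χ hodd f₀ f₁ hf₀0 hf₁0 hf₀ hf₁

/-- **Degeneracy from an odd character of `Aut(ℂ)` LOCAL on a set `S ⊆ φ₀(K_{i₀}) ∩ φ₁(K_{i₁})`**: the weights
`f_k(s) = χ(τ_s)` on the two slots are supplied by `exists_semiInvariant_of_local`, and the family is degenerate for
nondegenerate `Φ_{i₀}`, `Φ_{i₁}`; the rank is not additive. [cite: Gordon1999HodgeAVSurvey, §3 Theorem (proof) and 7.5–7.7] -/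
theorem cmFamilyRank_add_card_lt_of_oddChar_local {i₀ i₁ : I} (h01 : i₀ ≠ i₁) (Φ : ∀ i, CMType (K i))
    (hnd₀ : IsNondegenerate (Φ i₀)) (hnd₁ : IsNondegenerate (Φ i₁)) (χ : (ℂ ≃+* ℂ) → ℂ)
    (hmul : ∀ τ τ' : ℂ ≃+* ℂ, χ (τ * τ') = χ τ * χ τ') (hodd : χ (starRingAut : ℂ ≃+* ℂ) = -1) (S : Set ℂ)
    (hloc : ∀ τ τ' : ℂ ≃+* ℂ, (∀ x ∈ S, τ x = τ' x) → χ τ = χ τ') (φ₀ : K i₀ →+* ℂ) (φ₁ : K i₁ →+* ℂ)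
    (hS₀ : S ⊆ Set.range φ₀) (hS₁ : S ⊆ Set.range φ₁) :
    CMAlgebra.cmFamilyRank Φ + Fintype.card I < (∑ i, cmTypeRank (Φ i)) + 1 ∧ ¬ CMAlgebra.IsNondegenerateFamily Φ := by
  have h1 : χ 1 ≠ 0 := by rw [oddChar_one χ hmul hodd]; exact one_ne_zero
  obtain ⟨f₀, hf₀0, hf₀⟩ := exists_semiInvariant_of_local χ hmul h1 φ₀ (local_of_subset_range χ S hloc φ₀ hS₀)
  obtain ⟨f₁, hf₁0, hf₁⟩ := exists_semiInvariant_of_local χ hmul h1 φ₁ (local_of_subset_range χ S hloc φ₁ hS₁)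
  exact ⟨cmFamilyRank_add_card_lt_of_shared_oddChar h01 Φ hnd₀ hnd₁ χ hodd f₀ f₁ hf₀0 hf₁0 hf₀ hf₁,
    not_isNondegenerateFamily_of_shared_oddChar h01 Φ hnd₀ hnd₁ χ hodd f₀ f₁ hf₀0 hf₁0 hf₀ hf₁⟩

end Family

/-! ### Supply: odd characters from a normal subfield with abelian Galois group, not fixed by conjugation -/

section Supply

/-- An automorphism of `ℂ` fixes `ℚ`. [folklore] -/
private theorem ringEquiv_apply_algebraMap' (g : ℂ ≃+* ℂ) (q : ℚ) : g (algebraMap ℚ ℂ q) = algebraMap ℚ ℂ q := by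
  rw [eq_ratCast]
  exact map_ratCast g q

/-- **Odd characters of `Aut(ℂ)` local on a CM subfield with abelian Galois group.**  Let `F ≤ ℂ` be a finite NORMAL
extension of `ℚ` such that the automorphisms of `ℂ` commute on `F` (`τ τ' x = τ' τ x`, `x ∈ F`: `Gal(F/ℚ)` is
abelian) and complex conjugation moves some element of `F`.  Then there is `χ : Aut(ℂ) → ℂ`, multiplicative, with
`χ(conj) = −1`, whose value only depends on the restriction to `F`: the restriction `Aut(ℂ) → Gal(F/ℚ)` has abelian image
`H ∋ conj|_F ≠ 1`, and a character `ψ` of the finite abelian group `H` with `ψ(conj|_F) ≠ 1` (Pontryagin duality)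
has `ψ(conj|_F) = −1` since `conj² = 1`. [cite: Kubota1965, §4 Lemma 2 (proof: "let `ψ₁, …, ψ_m` be all characters
of `G` which take `−1` at `ρ`")] -/
theorem exists_oddChar_of_abelian (F : IntermediateField ℚ ℂ) [FiniteDimensional ℚ F]
    [@Normal ℚ F _ _ (IntermediateField.algebra' F)]
    (hcomm : ∀ τ τ' : ℂ ≃+* ℂ, ∀ x : ℂ, x ∈ F → τ (τ' x) = τ' (τ x))
    (hmove : ∃ x : ℂ, x ∈ F ∧ starRingEnd ℂ x ≠ x) :
    ∃ χ : (ℂ ≃+* ℂ) → ℂ, (∀ τ τ' : ℂ ≃+* ℂ, χ (τ * τ') = χ τ * χ τ') ∧ χ (starRingAut : ℂ ≃+* ℂ) = -1 ∧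
      ∀ τ τ' : ℂ ≃+* ℂ, (∀ x : ℂ, x ∈ F → τ x = τ' x) → χ τ = χ τ' := by
  classical
  letI iF : Algebra ℚ ↥F := IntermediateField.algebra' F
  -- restriction `r : Aut(ℂ) → Gal(F/ℚ)` and its values
  let toQ : (ℂ ≃+* ℂ) → (ℂ ≃ₐ[ℚ] ℂ) := fun τ => AlgEquiv.ofRingEquiv (f := τ) (ringEquiv_apply_algebraMap' τ)
  let r : (ℂ ≃+* ℂ) → (↥F ≃ₐ[ℚ] ↥F) := fun τ => (toQ τ).restrictNormal ↥F
  have hr : ∀ (τ : ℂ ≃+* ℂ) (x : ↥F), ((r τ x : ↥F) : ℂ) = τ x := fun τ x =>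
    AlgEquiv.restrictNormal_commutes (toQ τ) (↥F) x
  have r_mul : ∀ τ τ' : ℂ ≃+* ℂ, r (τ * τ') = r τ * r τ' := by
    intro τ τ'
    refine AlgEquiv.ext fun x => Subtype.ext ?_
    rw [AlgEquiv.mul_apply, hr, hr, hr]
    rfl
  have r_one : r 1 = 1 := by
    refine AlgEquiv.ext fun x => Subtype.ext ?_
    rw [hr, AlgEquiv.one_apply]
    rfl
  have r_loc : ∀ τ τ' : ℂ ≃+* ℂ, (∀ x : ℂ, x ∈ F → τ x = τ' x) → r τ = r τ' := by
    intro τ τ' h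
    refine AlgEquiv.ext fun x => Subtype.ext ?_
    rw [hr, hr]
    exact h x x.2
  -- `r` as a monoid hom; its image `H` is a finite abelian group
  let rh : (ℂ ≃+* ℂ) →* (↥F ≃ₐ[ℚ] ↥F) := { toFun := r, map_one' := r_one, map_mul' := r_mul }
  let H : Subgroup (↥F ≃ₐ[ℚ] ↥F) := rh.range
  have hHcomm : ∀ a b : ↥H, a * b = b * a := by
    rintro ⟨_, τ, rfl⟩ ⟨_, τ', rfl⟩
    refine Subtype.ext (AlgEquiv.ext fun x => Subtype.ext ?_)
    change ((r τ * r τ') x : ℂ) = ((r τ' * r τ) x : ℂ)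
    rw [AlgEquiv.mul_apply, AlgEquiv.mul_apply, hr, hr, hr, hr]
    exact hcomm τ τ' x x.2
  letI : CommGroup ↥H := { (inferInstance : Group ↥H) with mul_comm := hHcomm }
  -- complex conjugation restricted to `F`: an element `c ∈ H` of order two, non-trivial
  let c : ↥H := ⟨r (starRingAut : ℂ ≃+* ℂ), ⟨starRingAut, rfl⟩⟩
  have hc1 : c ≠ 1 := by
    obtain ⟨x, hxF, hx⟩ := hmove
    intro h
    have h' : r (starRingAut : ℂ ≃+* ℂ) = 1 := congrArg Subtype.val h
    have := hr (starRingAut : ℂ ≃+* ℂ) ⟨x, hxF⟩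
    rw [h', AlgEquiv.one_apply] at this
    -- `this : x = starRingAut x`
    apply hx
    rw [starRingEnd_apply, ← starRingAut_apply]
    exact this.symm
  have hc2 : c * c = 1 := by
    refine Subtype.ext ?_
    change r (starRingAut : ℂ ≃+* ℂ) * r (starRingAut : ℂ ≃+* ℂ) = 1
    rw [← r_mul, ← r_one]
    refine r_loc _ _ fun x _ => ?_
    change starRingAut (starRingAut x) = x
    simp
  -- an odd character of `H`
  have hc0 : Additive.ofMul c ≠ 0 := fun h => hc1 (by simpa using congrArg Additive.toMul h)
  obtain ⟨ψ, hψ⟩ := (AddChar.exists_apply_ne_zero (α := Additive ↥H)).2 hc0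
  have hψc : ψ (Additive.ofMul c) = -1 := by
    have hsq : ψ (Additive.ofMul c) * ψ (Additive.ofMul c) = 1 := by
      rw [← AddChar.map_add_eq_mul, ← ofMul_mul, hc2, ofMul_one, AddChar.map_zero_eq_one]
    rcases mul_self_eq_one_iff.1 hsq with h | h
    · exact (hψ h).elim
    · exact h
  refine ⟨fun τ => ψ (Additive.ofMul ⟨r τ, ⟨τ, rfl⟩⟩), fun τ τ' => ?_, hψc, fun τ τ' h => ?_⟩
  · have hm : (⟨r (τ * τ'), ⟨τ * τ', rfl⟩⟩ : ↥H) = ⟨r τ, ⟨τ, rfl⟩⟩ * ⟨r τ', ⟨τ', rfl⟩⟩ :=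
      Subtype.ext (r_mul τ τ')
    show ψ (Additive.ofMul (⟨r (τ * τ'), ⟨τ * τ', rfl⟩⟩ : ↥H)) =
      ψ (Additive.ofMul ⟨r τ, ⟨τ, rfl⟩⟩) * ψ (Additive.ofMul ⟨r τ', ⟨τ', rfl⟩⟩)
    rw [hm, ofMul_mul, AddChar.map_add_eq_mul]
  · show ψ (Additive.ofMul ⟨r τ, ⟨τ, rfl⟩⟩) = ψ (Additive.ofMul ⟨r τ', ⟨τ', rfl⟩⟩)
    congr 2
    exact Subtype.ext (r_loc τ τ' h)

end Supply

/-! ### Consequences for CM fields through a common subfield -/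

section Common

variable {I : Type} {K : I → Type} [∀ i, Field (K i)] [∀ i, NumberField (K i)] [∀ i, IsCMField (K i)] [Fintype I]
  [Nonempty I]

/-- **CM fields through a common normal subfield with abelian Galois group which is not totally real**: if a finite
normal `F ≤ ℂ` with commuting `ℂ`-automorphisms and not fixed pointwise by complex conjugation lies inside `φ₀(K_{i₀})`
and inside `φ₁(K_{i₁})` (`i₀ ≠ i₁`), then for NONDEGENERATE `Φ_{i₀}`, `Φ_{i₁}` the rank of `Φ` is not additive and the
family `Φ` is DEGENERATE: some `∏_i A_i^{k_i}` carries an exceptional Hodge class.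
[cite: Gordon1999HodgeAVSurvey, §3 Theorem (proof) and 7.5–7.7] [cite: Kubota1965, §4 Lemma 2] -/
theorem cmFamilyRank_add_card_lt_of_common_subfield {i₀ i₁ : I} (h01 : i₀ ≠ i₁) (Φ : ∀ i, CMType (K i))
    (hnd₀ : IsNondegenerate (Φ i₀)) (hnd₁ : IsNondegenerate (Φ i₁)) (F : IntermediateField ℚ ℂ)
    [FiniteDimensional ℚ F] [@Normal ℚ F _ _ (IntermediateField.algebra' F)]
    (hcomm : ∀ τ τ' : ℂ ≃+* ℂ, ∀ x : ℂ, x ∈ F → τ (τ' x) = τ' (τ x))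
    (hmove : ∃ x : ℂ, x ∈ F ∧ starRingEnd ℂ x ≠ x) (φ₀ : K i₀ →+* ℂ) (φ₁ : K i₁ →+* ℂ)
    (hF₀ : (F : Set ℂ) ⊆ Set.range φ₀) (hF₁ : (F : Set ℂ) ⊆ Set.range φ₁) :
    CMAlgebra.cmFamilyRank Φ + Fintype.card I < (∑ i, cmTypeRank (Φ i)) + 1 ∧ ¬ CMAlgebra.IsNondegenerateFamily Φ := by
  obtain ⟨χ, hmul, hodd, hloc⟩ := exists_oddChar_of_abelian F hcomm hmove
  exact cmFamilyRank_add_card_lt_of_oddChar_local h01 Φ hnd₀ hnd₁ χ hmul hodd (F : Set ℂ)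
    (fun τ τ' h => hloc τ τ' fun x hx => h x hx) φ₀ φ₁ hF₀ hF₁

/-- **… in particular the family is degenerate.** [cite: Gordon1999HodgeAVSurvey, 7.5–7.7] -/
theorem not_isNondegenerateFamily_of_common_subfield {i₀ i₁ : I} (h01 : i₀ ≠ i₁) (Φ : ∀ i, CMType (K i))
    (hnd₀ : IsNondegenerate (Φ i₀)) (hnd₁ : IsNondegenerate (Φ i₁)) (F : IntermediateField ℚ ℂ)
    [FiniteDimensional ℚ F] [@Normal ℚ F _ _ (IntermediateField.algebra' F)]
    (hcomm : ∀ τ τ' : ℂ ≃+* ℂ, ∀ x : ℂ, x ∈ F → τ (τ' x) = τ' (τ x))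
    (hmove : ∃ x : ℂ, x ∈ F ∧ starRingEnd ℂ x ≠ x) (φ₀ : K i₀ →+* ℂ) (φ₁ : K i₁ →+* ℂ)
    (hF₀ : (F : Set ℂ) ⊆ Set.range φ₀) (hF₁ : (F : Set ℂ) ⊆ Set.range φ₁) :
    ¬ CMAlgebra.IsNondegenerateFamily Φ :=
  (cmFamilyRank_add_card_lt_of_common_subfield h01 Φ hnd₀ hnd₁ F hcomm hmove φ₀ φ₁ hF₀ hF₁).2

end Common


end Literature.NumberTheory.ComplexMultiplication

end
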